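import Literature.MathematicalPhysics.QuantumFieldTheory.Balaban1983to89.B13PrimitiveKernels216

/-!
# `Balaban1983to89.B13PrimitiveKernels216Reduced` — T. Bałaban, *Renormalization group approach to lattice gauge field
theories. II. Cluster expansions*, Commun. Math. Phys. **116** (1988) 1–22 [Balaban1988RG2Cluster], pp. 13, 15–16: the
(2.16)-type named hypothesis `B13PrimitiveKernels216.Differences216` (cell locus L16a) for one (2.14)-term FROM THE
REDUCED INPUT LIST — (T3a) TWO σ-part bounds at the reference configuration (the Γ-kernel's `θ_σ,Γ` and the precision's
`θ_σ,E`; print «O(1)e^{−⅓δ₀M}», asserted) and (T3b) entrywise analyticity in the configuration of the Γ-kernel and of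
the PRECISION only, with the uniform torus-localised majorants `K_G`, `K_E` and the covariance majorant `K_Cs` — the
covariance's σ-part bound and its analyticity clause being DERIVED (`B13CovarianceDifference216.hdC_of_hdE`, resolvent
identity; `differentiableOn_matrix_inv` is not even needed: the covariance difference is taken at the END, after the
(𝐔, 𝐉)-part of the precision difference has been added by the Schwarz lemma).

statement-level skeleton of published theorems with citation tags; proofs where landed; nothing here is a claim about
the Yang–Mills mass gap

CITATION HEADER (verbatim, p. 15 [PDF 15] – p. 16 [PDF 16], as in `B13PrimitiveKernels216`): *"The quadratic forms and
covariances in H(Z) are analytic functions on the space of configurations (U, J) … For the pair (U, 0) the operators are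
symmetric, and the measure is positive … The general case is handled by a perturbative argument. … we replace the
operators by the corresponding operators with σ(Z) = 0, 𝐔 = U, 𝐉 = 0, and we estimate the error … with matrix elements
satisfying the bound* `|R₁(b, b′)| ≦ (O(1)e^{−⅓δ₀M} + O(α₀ + α₁)) exp(−½δ₀|b₋ − b′₋|).`  (2.16)".

WHAT IS REPRODUCED (cell `pub-balaban-gaps`, track G1, prover seat g1-p2 gen 2; binder (D4), NODE A.4 = (T3) — the
EXACT MISSING LEMMA of `HOME/g1/RESIDUE.md` §(D4) v1.8 as ONE hypothesis list): `differences216_of_analytic_two` —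
`B13PrimitiveKernels216.differences216_of_analytic` with the hypotheses `hσC` ((T3a) for the covariance) and `haC`
((T3b) analyticity of the covariance) REMOVED, replaced by the structural hypotheses the capstone
`B13Lemma3TorusPrimitive.h226_torus_of_primitives` takes anyway (`A(σ,u)` symmetric with `Re ≻ 0` at the configuration
`u`; `C ≻ 0`); output `Differences216` at a twice-dropped rate `κ″ < κ′ < κ` with
`θ_Γ = θ_σ,Γ + 2K_Gα/R`, `θ_E = θ_σ,E + 2K_Eα/R`, `θ_C = K_Cs·θ_E·(m(1+2/(κ−κ′))^ν)·K_Cs·(m(1+2/(κ′−κ″))^ν)`.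
* §2 `h226_torus_of_two` — (2.26) FOR ONE TERM of the torus model (`B13PrimitiveKernels216.h226_torus_of_kernelBounds`
  = r10's `h226_torus_of_primitives`) from `Localisation17a` and the TWO difference bounds `hdΓ`, `hdE` at a rate `κ₁`,
  two rate drops above the capstone's `κ`: the by-assertion kernel inputs of (2.26) for a typed term are SIX
  (`hG hΓ₀ hCs hC216 ∣ hdΓ hdE`).
HONEST SCOPE.  Plumbing of `differences216_of_analytic` (Schwarz lemma, plan-1) with `hdC_of_hdE` (resolvent identity,
this seat); no operator constructed, no random walk expansion performed; `θ_σ,Γ`, `θ_σ,E`, `K_G`, `K_E`, `K_Cs` and the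
two analyticity clauses REMAIN hypotheses (cell GAPS G-B9-10 ∕ G-B13-09 untouched).  No `sorry`, no definition, no new
named fact.  NOT B12 Thm 2, NOT `BetaPertH`, NOT continuum∕ℝ⁴, NOT Clay.
-/

namespace Literature.MathematicalPhysics.QuantumFieldTheory.Balaban1983to89.B13PrimitiveKernels216Reduced

open Metric Set Matrix
open Literature.MathematicalPhysics.QuantumFieldTheory.Balaban1983to89
open Literature.MathematicalPhysics.QuantumFieldTheory.Balaban1983to89.TreeLengthTorus (TPt)
open Literature.MathematicalPhysics.QuantumFieldTheory.Balaban1983to89.B5TorusCover (UT)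
open Literature.MathematicalPhysics.QuantumFieldTheory.Balaban1983to89.B9Thm37GlueTorus (tdist1 tdist1_nonneg)
open Literature.MathematicalPhysics.QuantumFieldTheory.Balaban1983to89.TreeLengthTorus (TDom tsys)
open Literature.MathematicalPhysics.QuantumFieldTheory.Balaban1983to89.TreeLengthTorusTransfer (tclosure)
open Literature.MathematicalPhysics.QuantumFieldTheory.Balaban1983to89.B13Lemma3TorusData (TBond)
open Literature.MathematicalPhysics.QuantumFieldTheory.Balaban1983to89.B13Lemma3TorusTerms (weight Z0)
open Literature.MathematicalPhysics.QuantumFieldTheory.Balaban1983to89.B13Term214 (term214 SepHolOn core214 F214)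
open Literature.MathematicalPhysics.QuantumFieldTheory.Balaban1983to89.B13Bound143 (invTau)
open Literature.MathematicalPhysics.QuantumFieldTheory.Balaban1983to89.B13PrimitiveKernels216
  (Localisation17a Differences216 sub_ref_le_of_analytic h226_torus_of_kernelBounds localisation17a_mono_rate
    differences216_of_two)
open Literature.MathematicalPhysics.QuantumFieldTheory.Balaban1983to89.B13CovarianceDifference216 (hdC_of_hdE)

noncomputable section

variable {E : Type*} [NormedAddCommGroup E] [NormedSpace ℂ E]
variable {d N' : ℕ} {ν : ℕ} {Nf : Fin ν → ℕ} [∀ i, NeZero (Nf i)]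
variable {Λ : Type} [Fintype Λ] [DecidableEq Λ] {C₀ : Type}

/-- **`Differences216` from the REDUCED (T3) input list.**  Joint kernel families `G(σ,u)` (the Γ-kernel of the term),
`A(σ,u)` (the precision; `A(σ,u)⁻¹ = C^{(k)}(Z₀,σ,𝐔,𝐉)` the covariance), σ on the polydisc `‖σ_j‖ ≤ e^{κ₁}`, `u` in the
configuration space `E` (`(𝐔,𝐉) = (U,0) + u`), with real reference values `G(0,0) = Γ₀`, `A(0,0)⁻¹ = C`, `C ≻ 0` (so `A(0,0) = C⁻¹`, derived — one
hypothesis fewer than `differences216_of_analytic`), and AT THE CONFIGURATION `u` (`‖u‖ ≤ α < R`) `A(σ,u)` symmetric with `Re A(σ,u) ≻ 0` on the polydisc.  IF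
(T3a) the σ-parts of the Γ-kernel and of the PRECISION at `u = 0` obey the (2.16) shape at rate `κ` (`θ_σ,Γ`, `θ_σ,E`)
and (T3b) `u ↦ G(σ,u)`, `u ↦ A(σ,u)` are entrywise analytic on the ball `‖u‖ < R` with uniform torus-localised majorants
`K_G`, `K_E` at rate `κ`, and the COVARIANCES `A(σ,u)⁻¹` have the uniform majorant `K_Cs` at rate `κ` on polydisc × ball,
THEN the section `σ ↦ (A(σ,u), G(σ,u))` satisfies `Differences216` at any rate `κ″ < κ′ < κ` (`0 ≤ κ″`) with
`θ_Γ = θ_σ,Γ + 2K_Gα/R`, `θ_E = θ_σ,E + 2K_Eα/R` (Schwarz lemma, `sub_ref_le_of_analytic`) and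
`θ_C = K_Cs·θ_E·(m(1+2/(κ−κ′))^ν)·K_Cs·(m(1+2/(κ′−κ″))^ν)` (resolvent identity, `hdC_of_hdE`, with `K₀ := K_Cs` from the
majorant at `(0,0)`).  Compared with `differences216_of_analytic`: no σ-part bound and no analyticity clause for the
covariance is assumed. [cite: Balaban1988RG2Cluster, (2.16) p.16, p.15, p.13] -/
theorem differences216_of_analytic_two (c : B13.Consts)
    (A2 : (TPt d N' → ℂ) → E → Matrix Λ Λ ℂ) (G2 : (TPt d N' → ℂ) → E → Matrix Λ (Λ ⊕ C₀) ℂ)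
    {Γ₀ : Matrix Λ (Λ ⊕ C₀) ℝ} {C : Matrix Λ Λ ℝ} (hC : C.PosDef) (locΛ : Λ → UT Nf) (locN : Λ ⊕ C₀ → UT Nf)
    {m : ℕ} (hfibΛ : ∀ x : UT Nf, (Finset.univ.filter fun i => locΛ i = x).card ≤ m)
    {R α kap kap' kap'' KG KCs KE θσΓ θσE : ℝ} (hR : 0 < R) (hαR : α < R) (hα : 0 ≤ α)
    (hkap'' : 0 ≤ kap'') (h1 : kap'' < kap') (h2 : kap' < kap)
    (hKG : 0 ≤ KG) (hKCs : 0 ≤ KCs) (hKE : 0 ≤ KE) (hθσΓ : 0 ≤ θσΓ) (hθσE : 0 ≤ θσE)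
    (hG0 : G2 0 0 = Γ₀.map (algebraMap ℝ ℂ)) (hC0 : (A2 0 0)⁻¹ = C.map (algebraMap ℝ ℂ))
    {u : E} (hu : ‖u‖ ≤ α)
    (hAs : ∀ σ : TPt d N' → ℂ, (∀ j, ‖σ j‖ ≤ Real.exp c.κ₁) → (A2 σ u).IsSymm)
    (hA : ∀ σ : TPt d N' → ℂ, (∀ j, ‖σ j‖ ≤ Real.exp c.κ₁) → ((A2 σ u).map Complex.re).PosDef)
    -- (T3a), reduced: the σ-parts of the Γ-kernel and of the PRECISION at the reference configuration
    (hσΓ : ∀ σ : TPt d N' → ℂ, (∀ j, ‖σ j‖ ≤ Real.exp c.κ₁) →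
      ∀ b j, ‖(G2 σ 0 - G2 0 0) b j‖ ≤ θσΓ * Real.exp (-(kap * tdist1 Nf (locΛ b) (locN j))))
    (hσE : ∀ σ : TPt d N' → ℂ, (∀ j, ‖σ j‖ ≤ Real.exp c.κ₁) →
      ∀ b b', ‖(A2 σ 0 - A2 0 0) b b'‖ ≤ θσE * Real.exp (-(kap * tdist1 Nf (locΛ b) (locΛ b'))))
    -- (T3b), reduced: analyticity of the Γ-kernel and of the PRECISION with uniform majorants; covariance majorant only
    (haΓ : ∀ σ : TPt d N' → ℂ, (∀ j, ‖σ j‖ ≤ Real.exp c.κ₁) →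
      ∀ b j, DifferentiableOn ℂ (fun u => G2 σ u b j) (ball 0 R))
    (hmΓ : ∀ σ : TPt d N' → ℂ, (∀ j, ‖σ j‖ ≤ Real.exp c.κ₁) → ∀ u ∈ ball (0 : E) R,
      ∀ b j, ‖G2 σ u b j‖ ≤ KG * Real.exp (-(kap * tdist1 Nf (locΛ b) (locN j))))
    (haE : ∀ σ : TPt d N' → ℂ, (∀ j, ‖σ j‖ ≤ Real.exp c.κ₁) →
      ∀ b b', DifferentiableOn ℂ (fun u => A2 σ u b b') (ball 0 R))
    (hmE : ∀ σ : TPt d N' → ℂ, (∀ j, ‖σ j‖ ≤ Real.exp c.κ₁) → ∀ u ∈ ball (0 : E) R,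
      ∀ b b', ‖A2 σ u b b'‖ ≤ KE * Real.exp (-(kap * tdist1 Nf (locΛ b) (locΛ b'))))
    (hmC : ∀ σ : TPt d N' → ℂ, (∀ j, ‖σ j‖ ≤ Real.exp c.κ₁) → ∀ u ∈ ball (0 : E) R,
      ∀ b b', ‖(A2 σ u)⁻¹ b b'‖ ≤ KCs * Real.exp (-(kap * tdist1 Nf (locΛ b) (locΛ b')))) :
    Differences216 c (fun σ => A2 σ u) (fun σ => G2 σ u) Γ₀ C locΛ locN kap'' (θσΓ + 2 * KG * α / R)
      (KCs * (θσE + 2 * KE * α / R) * (m * (1 + 2 / (kap - kap')) ^ ν) * KCs * (m * (1 + 2 / (kap' - kap'')) ^ ν))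
      (θσE + 2 * KE * α / R) := by
  have huR : u ∈ ball (0 : E) R := by rw [mem_ball, dist_zero_right]; exact hu.trans_lt hαR
  -- the reference precision identity `A(0,0) = C⁻¹` is a CONSEQUENCE of `A(0,0)⁻¹ = C` and `C ≻ 0`
  have hE0 : A2 0 0 = C⁻¹.map (algebraMap ℝ ℂ) := by
    have hCu : IsUnit C.det := hC.det_pos.ne'.isUnit
    have hmul : C⁻¹.map (algebraMap ℝ ℂ) * C.map (algebraMap ℝ ℂ) = 1 := by
      rw [← Matrix.map_mul, Matrix.nonsing_inv_mul C hCu, Matrix.map_one _ (map_zero _) (map_one _)]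
    have hCmu : IsUnit (C.map (algebraMap ℝ ℂ)) :=
      (Matrix.isUnit_iff_isUnit_det _).2 (Matrix.isUnit_det_of_left_inverse hmul)
    have hAu : IsUnit (A2 0 0).det := by
      rw [← Matrix.isUnit_iff_isUnit_det, ← Matrix.isUnit_nonsing_inv_iff, hC0]; exact hCmu
    rw [← Matrix.nonsing_inv_nonsing_inv (A2 0 0) hAu, hC0]
    exact Matrix.inv_eq_left_inv hmul
  have hle : kap'' ≤ kap := (h1.trans h2).le
  have h0 : ∀ j, ‖(0 : TPt d N' → ℂ) j‖ ≤ Real.exp c.κ₁ := fun _ => by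
    rw [Pi.zero_apply, norm_zero]; exact (Real.exp_pos _).le
  have hθE' : 0 ≤ θσE + 2 * KE * α / R := add_nonneg hθσE (by positivity)
  have hθΓ' : 0 ≤ θσΓ + 2 * KG * α / R := add_nonneg hθσΓ (by positivity)
  -- the two Schwarz-lemma fields at rate κ (as in `differences216_of_analytic`)
  have hdΓ : ∀ σ : TPt d N' → ℂ, (∀ j, ‖σ j‖ ≤ Real.exp c.κ₁) → ∀ b j,
      ‖(G2 σ u - Γ₀.map (algebraMap ℝ ℂ)) b j‖
        ≤ (θσΓ + 2 * KG * α / R) * Real.exp (-(kap * tdist1 Nf (locΛ b) (locN j))) := by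
    intro σ hσ b j
    have hσ' : ∀ b j, ‖(G2 σ 0 - Γ₀.map (algebraMap ℝ ℂ)) b j‖
        ≤ θσΓ * Real.exp (-(kap * tdist1 Nf (locΛ b) (locN j))) := by rw [← hG0]; exact hσΓ σ hσ
    exact sub_ref_le_of_analytic (K := G2 σ) hR hKG hαR (fun b j => (Real.exp_pos _).le) hσ' (haΓ σ hσ)
      (hmΓ σ hσ) hu b j
  have hdE : ∀ σ : TPt d N' → ℂ, (∀ j, ‖σ j‖ ≤ Real.exp c.κ₁) → ∀ b b',
      ‖(A2 σ u - C⁻¹.map (algebraMap ℝ ℂ)) b b'‖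
        ≤ (θσE + 2 * KE * α / R) * Real.exp (-(kap * tdist1 Nf (locΛ b) (locΛ b'))) := by
    intro σ hσ b b'
    have hσ' : ∀ b b', ‖(A2 σ 0 - C⁻¹.map (algebraMap ℝ ℂ)) b b'‖
        ≤ θσE * Real.exp (-(kap * tdist1 Nf (locΛ b) (locΛ b'))) := by rw [← hE0]; exact hσE σ hσ
    exact sub_ref_le_of_analytic (K := A2 σ) hR hKE hαR (fun b b' => (Real.exp_pos _).le) hσ' (haE σ hσ)
      (hmE σ hσ) hu b b'
  -- the reference covariance's localisation from the majorant at (0,0)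
  have hC216 : ∀ b b', ‖C b b'‖ ≤ KCs * Real.exp (-(kap * tdist1 Nf (locΛ b) (locΛ b'))) := fun b b' => by
    have h := hmC 0 h0 0 (mem_ball_self hR) b b'
    rwa [hC0, Matrix.map_apply, Complex.coe_algebraMap, Complex.norm_real] at h
  -- the covariance field by the resolvent identity, at rate κ″
  have hdC := hdC_of_hdE c.κ₁ (fun σ => A2 σ u) hC hAs hA locΛ hfibΛ hkap'' h1 h2 hKCs hKCs hθE'
    (fun σ hσ => hmC σ hσ u huR) hC216 hdE
  refine ⟨fun σ hσ b j => (hdΓ σ hσ b j).trans ?_, hdC, fun σ hσ b b' => (hdE σ hσ b b').trans ?_⟩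
  · exact mul_le_mul_of_nonneg_left
      (Real.exp_le_exp.2 (neg_le_neg (mul_le_mul_of_nonneg_right hle (tdist1_nonneg _ _)))) hθΓ'
  · exact mul_le_mul_of_nonneg_left
      (Real.exp_le_exp.2 (neg_le_neg (mul_le_mul_of_nonneg_right hle (tdist1_nonneg _ _)))) hθE'

/-! ## §2. (2.26) for one term of the torus model from the REDUCED primitive list (six kernel binders) -/

section Joiner

variable {L : ℕ} [NeZero L] [NeZero N'] {M : ℕ} [Fintype C₀] [DecidableEq C₀]

open Classical in
/-- **(2.26) FOR ONE TERM of the torus model from L17a and TWO σ-difference bounds** — `B13PrimitiveKernels216.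
h226_torus_of_kernelBounds` (= `B13Lemma3TorusPrimitive.h226_torus_of_primitives` over the named hypotheses) with
`Differences216` SUPPLIED by `differences216_of_two`: the kernel inputs are `Localisation17a` at a rate `κ₁` and the
Γ-kernel and PRECISION difference bounds `hdΓ` (`θ_Γ`), `hdE` (`θ_E`) at rate `κ₁`, with two extra rate drops
`κ₁ > κ₂ > κ` above the capstone's `κ > κ′ > κ″ > 0`; the covariance constant is the derived
`θ_C = K_Cs·θ_E·(m(1+2/(κ₁−κ₂))^ν)·K₀·(m(1+2/(κ₂−κ))^ν)` wherever the capstone mentions `θ_C` (only in `hθR1le`).  Every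
other binder is the capstone's, unchanged and in the same order.  So the by-assertion kernel inputs of (2.26) for a
typed term are SIX: `hG hΓ₀ hCs hC216` (L17a) and `hdΓ hdE` (L16a). [cite: Balaban1988RG2Cluster, (2.14)–(2.16) pp.15–16, (2.26) p.17] -/
theorem h226_torus_of_two (c : B13.Consts) (hκ₁ : 1 ≤ c.κ₁) (hα₆ : c.α₆ ≠ 0)
    (Z : TDom d N') (t : Finset (TDom d (L * N')) × Finset (TBond d M (L * N')))
    (hpos : ∀ Y : TDom d (L * N'), 0 < invTau c ((tsys d (L * N')).dj Y))
    (hhalf : ∀ Y : TDom d (L * N'), invTau c ((tsys d (L * N')).dj Y) ≤ 1 / 2)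
    {Uσ Uτ : Set ℂ} (hUσ : IsOpen Uσ) (hUτ : IsOpen Uτ) (hUexp : closedBall (0 : ℂ) (Real.exp c.κ₁) ⊆ Uσ)
    (hUtau : ∀ Y : TDom d (L * N'), closedBall (0 : ℂ) ((invTau c ((tsys d (L * N')).dj Y))⁻¹) ⊆ Uτ)
    {r : ℝ} (hr : 0 < r) (hr' : r ≤ Real.exp c.κ₁ - 1)
    (hsubτ : ∀ s ∈ Set.uIcc (0 : ℝ) 1, closedBall (s : ℂ) r ⊆ Uτ)
    (lZ : List (TPt d N')) (hlZ : lZ.Nodup ∧ lZ.toFinset = Z.1 \ tclosure L N' (Z0 M t))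
    (lD : List (TDom d (L * N'))) (hlD : lD.Nodup ∧ lD.toFinset = t.1)
    (A : (TPt d N' → ℂ) → Matrix Λ Λ ℂ) (Γ : (TPt d N' → ℂ) → (Λ ⊕ C₀ → ℝ) → (Λ → ℂ))
    (χY₀ χcP : (Λ → ℝ) → ℝ) (hχ0 : ∀ B, 0 ≤ χY₀ B) (hχc0 : ∀ B, 0 ≤ χcP B) (Dfam : Finset (TDom d (L * N')))
    (V : TDom d (L * N') → (Λ → ℝ) → ℂ)
    (hΨσ : ∀ τ : TDom d (L * N') → ℂ, (∀ j, τ j ∈ Uτ) →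
      SepHolOn Uσ (fun σ => core214 A Γ (F214 t.2.card χY₀ χcP Dfam V) σ τ))
    (hΨτ : ∀ σ : TPt d N' → ℂ, (∀ j, σ j ∈ Uσ) →
      SepHolOn Uτ (fun τ => core214 A Γ (F214 t.2.card χY₀ χcP Dfam V) σ τ))
    {C : Matrix Λ Λ ℝ} (hC : C.PosDef) (Γ₀ : Matrix Λ (Λ ⊕ C₀) ℝ)
    (hAs : ∀ σ : TPt d N' → ℂ, (∀ j, ‖σ j‖ ≤ Real.exp c.κ₁) → (A σ).IsSymm)
    (hA : ∀ σ : TPt d N' → ℂ, (∀ j, ‖σ j‖ ≤ Real.exp c.κ₁) → ((A σ).map Complex.re).PosDef)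
    (G : (TPt d N' → ℂ) → Matrix Λ (Λ ⊕ C₀) ℂ)
    (hlin : ∀ σ : TPt d N' → ℂ, (∀ j, ‖σ j‖ ≤ Real.exp c.κ₁) →
      ∀ X : Λ ⊕ C₀ → ℝ, Γ σ X = G σ *ᵥ fun j => (X j : ℂ))
    {γ₂ rP a₂₀ w : ℝ} (qP : (Λ → ℝ) → ℝ)
    (h222 : ∀ B, χY₀ B * χcP B ≤ Real.exp (-(γ₂ / 2 * rP ^ 2 * (t.2.card : ℕ)) + γ₂ / 2 * qP B)) (hγ₂ : 0 ≤ γ₂)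
    (hqP : ∀ B, qP B ≤ B ⬝ᵥ B)
    (h220R : ∀ B, ∑ Y ∈ Dfam, (invTau c ((tsys d (L * N')).dj Y))⁻¹ * ‖V Y B‖ ≤ a₂₀ / 2 * (B ⬝ᵥ B) + w)
    (ha0 : 0 ≤ a₂₀)
    (locΛ : Λ → UT Nf) (locN : Λ ⊕ C₀ → UT Nf) {m : ℕ}
    (hfibΛ : ∀ x : UT Nf, (Finset.univ.filter fun i => locΛ i = x).card ≤ m)
    (hfibN : ∀ x : UT Nf, (Finset.univ.filter fun j => locN j = x).card ≤ m)
    {kap kap' kap'' kap₁ kap₂ θ θE θΓ KG KΓ KCs K₀ : ℝ} (hkap'' : 0 < kap'') (h1 : kap'' < kap') (h2 : kap' < kap)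
    (h3 : kap < kap₂) (h4 : kap₂ < kap₁)
    (hθE : 0 ≤ θE) (hθΓ : 0 ≤ θΓ) (hKG : 0 ≤ KG) (hKΓ : 0 ≤ KΓ) (hKCs : 0 ≤ KCs) (hK₀ : 0 ≤ K₀)
    (hθEle : θE ≤ θ) (hθΓle : θΓ ≤ θ)
    (hθR1le : (m * (1 + 2 / (kap - kap')) ^ ν) * (m * (1 + 2 / (kap' - kap'')) ^ ν)
      * (θΓ * KCs * KG
        + KΓ * (KCs * θE * (m * (1 + 2 / (kap₁ - kap₂)) ^ ν) * K₀ * (m * (1 + 2 / (kap₂ - kap)) ^ ν)) * KG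
        + KΓ * K₀ * θΓ) ≤ θ)
    -- THE REDUCED KERNEL INPUTS: L17a at rate κ₁, and the TWO difference bounds hdΓ, hdE at rate κ₁
    (h17 : Localisation17a c A G Γ₀ C locΛ locN kap₁ KG KΓ KCs K₀)
    (hdΓ : ∀ σ : TPt d N' → ℂ, (∀ j, ‖σ j‖ ≤ Real.exp c.κ₁) →
      ∀ b j, ‖(G σ - Γ₀.map (algebraMap ℝ ℂ)) b j‖ ≤ θΓ * Real.exp (-(kap₁ * tdist1 Nf (locΛ b) (locN j))))
    (hdE : ∀ σ : TPt d N' → ℂ, (∀ j, ‖σ j‖ ≤ Real.exp c.κ₁) →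
      ∀ b b', ‖(A σ - C⁻¹.map (algebraMap ℝ ℂ)) b b'‖ ≤ θE * Real.exp (-(kap₁ * tdist1 Nf (locΛ b) (locΛ b'))))
    (hsmallKθ : K₀ * (m * (1 + 2 / kap) ^ ν) * (θ * (m * (1 + 2 / kap'') ^ ν)) < 1)
    {cE g : ℝ} (hc0 : 0 ≤ cE) (hc : ∀ k, hC.1.eigenvalues k ≤ cE)
    (hαc : (2 * (θ * (m * (1 + 2 / kap'') ^ ν)) + (γ₂ + a₂₀)) * cE ≤ 1 / 2) (hg : 0 ≤ g)
    (hΓq : ∀ X : Λ ⊕ C₀ → ℝ, (Γ₀ *ᵥ X) ⬝ᵥ (C *ᵥ (Γ₀ *ᵥ X)) ≤ g * (X ⬝ᵥ X))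
    (hsmall : (2 * (θ * (m * (1 + 2 / kap'') ^ ν)) + (γ₂ + a₂₀)) * (1 + 2 * cE * g) ≤ 1 / 2)
    {a a₅ : ℝ} (hPa : a ≤ γ₂ * rP ^ 2)
    (hvol : 2 * (K₀ * (m * (1 + 2 / kap) ^ ν) * (θ * (m * (1 + 2 / kap'') ^ ν))
              * (1 + (1 - K₀ * (m * (1 + 2 / kap) ^ ν) * (θ * (m * (1 + 2 / kap'') ^ ν)))⁻¹) / 2)
          * (Fintype.card Λ : ℝ)
        + w + (2 * (θ * (m * (1 + 2 / kap'') ^ ν)) + (γ₂ + a₂₀)) * cE * (Fintype.card Λ : ℝ)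
        + (2 * (θ * (m * (1 + 2 / kap'') ^ ν)) + (γ₂ + a₂₀)) * (1 + 2 * cE * g) * (Fintype.card (Λ ⊕ C₀) : ℝ)
        ≤ a₅ * ((Z.1).card : ℝ)) :
    ‖term214 r lZ lD (core214 A Γ (F214 t.2.card χY₀ χcP Dfam V)) 0 0‖ ≤
      weight L M c Z a t * Real.exp (a₅ * ((Z.1).card : ℝ)) := by
  have hkap0 : 0 ≤ kap := (hkap''.trans (h1.trans h2)).le
  have h12 : 0 < kap₁ - kap₂ := sub_pos.2 h4
  have h2k : 0 < kap₂ - kap := sub_pos.2 h3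
  have hθC : 0 ≤ KCs * θE * (m * (1 + 2 / (kap₁ - kap₂)) ^ ν) * K₀ * (m * (1 + 2 / (kap₂ - kap)) ^ ν) := by
    have ha : 0 ≤ (m : ℝ) * (1 + 2 / (kap₁ - kap₂)) ^ ν :=
      mul_nonneg (Nat.cast_nonneg m) (pow_nonneg (by positivity) ν)
    have hb : 0 ≤ (m : ℝ) * (1 + 2 / (kap₂ - kap)) ^ ν :=
      mul_nonneg (Nat.cast_nonneg m) (pow_nonneg (by positivity) ν)
    exact mul_nonneg (mul_nonneg (mul_nonneg (mul_nonneg hKCs hθE) ha) hK₀) hb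
  exact h226_torus_of_kernelBounds c hκ₁ hα₆ Z t hpos hhalf hUσ hUτ hUexp hUtau hr hr' hsubτ lZ hlZ lD hlD A Γ χY₀
    χcP hχ0 hχc0 Dfam V hΨσ hΨτ hC Γ₀ hAs hA G hlin qP h222 hγ₂ hqP h220R ha0 locΛ locN hfibΛ hfibN hkap'' h1 h2
    hθE hθΓ hθC hKG hKΓ hKCs hK₀ hθEle hθΓle hθR1le
    (localisation17a_mono_rate (h3.trans h4).le hKG hKΓ hKCs hK₀ h17)
    (differences216_of_two c hC hAs hA locΛ locN hfibΛ hkap0 h3 h4 hKCs hK₀ hθΓ hθE h17 hdΓ hdE)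
    hsmallKθ hc0 hc hαc hg hΓq hsmall hPa hvol

end Joiner

end

end Literature.MathematicalPhysics.QuantumFieldTheory.Balaban1983to89.B13PrimitiveKernels216Reduced
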